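import Literature.Analysis.UnboundedOperators.HeatKernelGradient
import Literature.Analysis.UnboundedOperators.HeatKernelLpSmoothingProofs
import HarnessLib

/-!
# Gradient smoothing estimate for the heat semigroup: `‖∇e^{tΔ}f‖_{L^q} ≤ C t^{-1/2-(n/2)(1/p-1/q)} ‖f‖_{L^p}`

Analysis/UnboundedOperators support file (heat kernel on a finite-dimensional real inner product
space `E`, `n = dim E`, accepted `Literature.heatExtension f t = e^{tΔ}f`). It composes three accepted
and PROVED facts of `HeatKernel.lean`,

* the semigroup law `heatExtension_add` (`e^{tΔ} = e^{(t/2)Δ} e^{(t/2)Δ}`),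
* the gradient bound `eLpNorm_fderiv_heatExtension_le` (`‖∇e^{sΔ}g‖_q ≤ C₁ s^{-1/2} ‖g‖_q`),
* the `L^p → L^q` smoothing bound `eLpNorm_heatExtension_le_rpow`
  (`‖e^{sΔ}f‖_q ≤ C₂ s^{-(n/2)(1/p-1/q)} ‖f‖_p`),

into the mixed estimate (Giga–Giga–Saal 2010, §1.1.3, derivative and `L^p`–`L^q` estimates for
the heat semigroup; Robinson–Rodrigo–Sadowski 2016, App. D.2)

* `Literature.Analysis.UnboundedOperators.exists_eLpNorm_fderiv_heatExtension_le_rpow`: for `1 ≤ p ≤ q ≤ ∞` there is `C` with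
  `‖∇e^{tΔ}f‖_{L^q} ≤ C t^{-(1/2 + (n/2)(1/p - 1/q))} ‖f‖_{L^p}` for all `f ∈ L^p`, `0 < t`,

and records the two three-dimensional cases with exponent `-3/4` used for Navier–Stokes in
`L³(ℝ³)` (`(p, q) = (2, 3)` and `(3/2, 2)`:
`exists_eLpNorm_three_fderiv_heatExtension_le_of_finrank_eq_three`,
`exists_eLpNorm_two_fderiv_heatExtension_le_of_finrank_eq_three`). Consumer: the `L²`-duality
proof of local uniqueness of mild solutions in `C([0,T); L³)` (tree facts
`Fluid.IsMildNSSolutionOn.ae_eq_Ico_of_ae_eq_Icc_three`, `NS.kato_unique`), where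
`|∫ G : ∇e^{σΔ}φ| ≤ ‖G‖_{3/2} ‖∇e^{σΔ}φ‖₃ ≤ C σ^{-3/4} ‖G‖_{3/2} ‖φ‖₂` makes the very weak pairing of
the difference of two solutions an `L²`-bounded functional (Lemarié-Rieusset 2016, §7.9).

## Mathlib / tree search

Mathlib has no heat semigroup (see `HeatKernel.lean`); the tree has the three ingredients above
(discharged in `HeatKernel.lean`, `HeatKernelGradient.lean`, `HeatKernelLpSmoothingProofs.lean`)
but no composite gradient-smoothing statement (`lean search 'fderiv_heatExtension'`: only the
`q = p` bound). Nothing is duplicated.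

## References

* M.-H. Giga, Y. Giga, J. Saal, *Nonlinear Partial Differential Equations* (Birkhäuser 2010),
  §1.1.3 (`L^p`–`L^q` and derivative estimates for `e^{tΔ}`). Bib key `GigaGigaSaal2010`.
* J. C. Robinson, J. L. Rodrigo, W. Sadowski, *The Three-Dimensional Navier–Stokes Equations*
  (CUP 2016), App. D.2. Bib key `RobinsonRodrigoSadowski2016`.
* P. G. Lemarié-Rieusset, *The Navier–Stokes problem in the 21st century* (2016), §7.9.
  Bib key `LemarieRieusset2016`.
-/

noncomputable section

open MeasureTheory Filter Topology
open scoped Real ENNReal NNReal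

namespace Literature.Analysis.UnboundedOperators

variable {E : Type*} [NormedAddCommGroup E] [InnerProductSpace ℝ E] [FiniteDimensional ℝ E]
  [MeasurableSpace E] [BorelSpace E]
variable {F : Type*} [NormedAddCommGroup F] [NormedSpace ℝ F] [CompleteSpace F]

/-- Elementary identity behind the composite estimate: for `0 < t` and real `a`, `b`,
`(t/2)^{-a} (t/2)^{-b} = 2^{a+b} t^{-(a+b)}`. [folklore] -/
theorem half_rpow_neg_mul_half_rpow_neg {t : ℝ} (ht : 0 < t) (a b : ℝ) :
    (t / 2) ^ (-a) * (t / 2) ^ (-b) = (2 : ℝ) ^ (a + b) * t ^ (-(a + b)) := by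
  have ht2 : 0 < t / 2 := by positivity
  rw [← Real.rpow_add ht2, show -a + -b = -(a + b) by ring, Real.div_rpow ht.le zero_le_two,
    Real.rpow_neg zero_le_two, div_inv_eq_mul, mul_comm]

variable (E F) in
/-- **Gradient smoothing estimate for the heat semigroup, `L^p → L^q`.** For
`1 ≤ p ≤ q ≤ ∞` there is `C = C(E, p, q)` with
`‖∇ e^{tΔ} f‖_{L^q} ≤ C t^{-(1/2 + (n/2)(1/p - 1/q))} ‖f‖_{L^p}` for all `f ∈ L^p` and `0 < t`
(`n = dim E`, `1/∞ = 0` via `ENNReal.toReal`). Proof: semigroup law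
`e^{tΔ} = e^{(t/2)Δ} e^{(t/2)Δ}` (`heatExtension_add`), the gradient bound
`‖∇e^{(t/2)Δ}g‖_q ≤ C₁ (t/2)^{-1/2} ‖g‖_q` (`eLpNorm_fderiv_heatExtension_le`) applied to
`g = e^{(t/2)Δ}f ∈ L^q`, and the smoothing bound `‖e^{(t/2)Δ}f‖_q ≤ C₂ (t/2)^{-(n/2)(1/p-1/q)} ‖f‖_p`
(`eLpNorm_heatExtension_le_rpow`), all three PROVED in the tree. Giga–Giga–Saal 2010, §1.1.3
(derivative and `L^p`–`L^q` estimates for `e^{tΔ}`); Robinson–Rodrigo–Sadowski 2016, App. D.2.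
The cases used for Navier–Stokes in `L³(ℝ³)` are `(p, q) = (2, 3)` and `(3/2, 2)`, both with
exponent `-3/4`. [cite: GigaGigaSaal2010, §1.1.3] -/
theorem exists_eLpNorm_fderiv_heatExtension_le_rpow {p q : ℝ≥0∞} (hp : 1 ≤ p) (hpq : p ≤ q) :
    ∃ C : ℝ≥0, ∀ (f : E → F), MemLp f p volume → ∀ t : ℝ, 0 < t →
      eLpNorm (fderiv ℝ (heatExtension f t)) q volume ≤
        C * ENNReal.ofReal (t ^ (-(1 / 2 + (Module.finrank ℝ E : ℝ) / 2 *
          ((1 / p).toReal - (1 / q).toReal)))) * eLpNorm f p volume := by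
  obtain ⟨C₁, hC₁⟩ := eLpNorm_fderiv_heatExtension_le_holds (E := E) (F := F) (hp.trans hpq)
  obtain ⟨C₂, hC₂⟩ := eLpNorm_heatExtension_le_rpow_holds (E := E) (F := F) hp hpq
  set a : ℝ := (Module.finrank ℝ E : ℝ) / 2 * ((1 / p).toReal - (1 / q).toReal) with ha
  refine ⟨C₁ * C₂ * NNReal.mk ((2 : ℝ) ^ (1 / 2 + a)) (by positivity), fun f hf t ht => ?_⟩
  have ht2 : 0 < t / 2 := by positivity
  -- `g = e^{(t/2)Δ} f ∈ L^q`
  set g : E → F := heatExtension f (t / 2) with hg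
  have hg_bound : eLpNorm g q volume ≤ C₂ * ENNReal.ofReal ((t / 2) ^ (-a)) * eLpNorm f p volume := by
    have h := hC₂ f hf (t / 2) ht2
    rwa [neg_mul, ← ha] at h
  have hgq : MemLp g q volume :=
    ⟨(memLp_heatExtension_holds hf hp ht2).1,
      hg_bound.trans_lt (ENNReal.mul_lt_top (ENNReal.mul_lt_top ENNReal.coe_lt_top
        ENNReal.ofReal_lt_top) hf.eLpNorm_lt_top)⟩
  -- semigroup law and the two estimates
  have hsemi : heatExtension f t = heatExtension g (t / 2) := by
    rw [hg, heatExtension_add_holds hf hp ht2 ht2, add_halves]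
  rw [hsemi]
  calc eLpNorm (fderiv ℝ (heatExtension g (t / 2))) q volume
      ≤ C₁ * ENNReal.ofReal ((t / 2) ^ (-(1 / 2 : ℝ))) * eLpNorm g q volume := hC₁ g hgq (t / 2) ht2
    _ ≤ C₁ * ENNReal.ofReal ((t / 2) ^ (-(1 / 2 : ℝ))) *
          (C₂ * ENNReal.ofReal ((t / 2) ^ (-a)) * eLpNorm f p volume) := by gcongr
    _ = (C₁ * C₂ * NNReal.mk ((2 : ℝ) ^ (1 / 2 + a)) (by positivity) : ℝ≥0) *
          ENNReal.ofReal (t ^ (-(1 / 2 + a))) * eLpNorm f p volume := by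
        have h2a : (0 : ℝ) ≤ (2 : ℝ) ^ (1 / 2 + a) := by positivity
        have key : ENNReal.ofReal ((t / 2) ^ (-(1 / 2 : ℝ))) * ENNReal.ofReal ((t / 2) ^ (-a)) =
            ENNReal.ofReal ((2 : ℝ) ^ (1 / 2 + a)) * ENNReal.ofReal (t ^ (-(1 / 2 + a))) := by
          rw [← ENNReal.ofReal_mul (Real.rpow_nonneg ht2.le _), ← ENNReal.ofReal_mul h2a,
            half_rpow_neg_mul_half_rpow_neg ht]
        rw [ENNReal.coe_mul, ENNReal.coe_mul,
          show ((NNReal.mk ((2 : ℝ) ^ (1 / 2 + a)) h2a : ℝ≥0) : ℝ≥0∞) =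
            ENNReal.ofReal ((2 : ℝ) ^ (1 / 2 + a)) from (ENNReal.ofReal_eq_coe_nnreal h2a).symm]
        calc (C₁ : ℝ≥0∞) * ENNReal.ofReal ((t / 2) ^ (-(1 / 2 : ℝ))) *
              (C₂ * ENNReal.ofReal ((t / 2) ^ (-a)) * eLpNorm f p volume)
            = C₁ * C₂ * (ENNReal.ofReal ((t / 2) ^ (-(1 / 2 : ℝ))) *
                ENNReal.ofReal ((t / 2) ^ (-a))) * eLpNorm f p volume := by ring
          _ = _ := by rw [key]; ring

/-- The case `p = 2`, `q = 3`, `dim E = 3` (exponent `-(1/2 + (3/2)(1/2 - 1/3)) = -3/4`):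
`‖∇e^{tΔ}φ‖_{L³} ≤ C t^{-3/4} ‖φ‖_{L²}`, the bound that makes the very weak pairing
`∫₀^δ ∫ G : ∇e^{ν(t-s)Δ}φ` of an `L^{3/2}` tensor `G` with a test field `φ` an `L²`-bounded
functional of `φ` (Lemarié-Rieusset 2016, §7.9; Giga–Giga–Saal 2010, §1.1.3). [cite: GigaGigaSaal2010, §1.1.3] -/
theorem exists_eLpNorm_three_fderiv_heatExtension_le_of_finrank_eq_three
    (hE : Module.finrank ℝ E = 3) :
    ∃ C : ℝ≥0, ∀ (f : E → F), MemLp f 2 volume → ∀ t : ℝ, 0 < t →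
      eLpNorm (fderiv ℝ (heatExtension f t)) 3 volume ≤
        C * ENNReal.ofReal (t ^ (-(3 / 4 : ℝ))) * eLpNorm f 2 volume := by
  obtain ⟨C, hC⟩ := exists_eLpNorm_fderiv_heatExtension_le_rpow E F (p := 2) (q := 3)
    (by norm_num) (by norm_num)
  refine ⟨C, fun f hf t ht => ?_⟩
  have h := hC f hf t ht
  have hexp : -(1 / 2 + (Module.finrank ℝ E : ℝ) / 2 * ((1 / (2 : ℝ≥0∞)).toReal -
      (1 / (3 : ℝ≥0∞)).toReal)) = -(3 / 4 : ℝ) := by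
    rw [hE]
    norm_num [ENNReal.toReal_div, ENNReal.toReal_ofNat]
  rwa [hexp] at h

/-- The case `p = 3/2`, `q = 2`, `dim E = 3` (exponent `-(1/2 + (3/2)(2/3 - 1/2)) = -3/4`):
`‖∇e^{tΔ}G‖_{L²} ≤ C t^{-3/4} ‖G‖_{L^{3/2}}` (Giga–Giga–Saal 2010, §1.1.3). [cite: GigaGigaSaal2010, §1.1.3] -/
theorem exists_eLpNorm_two_fderiv_heatExtension_le_of_finrank_eq_three
    (hE : Module.finrank ℝ E = 3) :
    ∃ C : ℝ≥0, ∀ (f : E → F), MemLp f (3 / 2) volume → ∀ t : ℝ, 0 < t →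
      eLpNorm (fderiv ℝ (heatExtension f t)) 2 volume ≤
        C * ENNReal.ofReal (t ^ (-(3 / 4 : ℝ))) * eLpNorm f (3 / 2) volume := by
  have h32 : (1 : ℝ≥0∞) ≤ 3 / 2 := by
    rw [ENNReal.le_div_iff_mul_le (by norm_num) (by norm_num)]; norm_num
  have h32' : (3 / 2 : ℝ≥0∞) ≤ 2 := by
    rw [ENNReal.div_le_iff_le_mul (by norm_num) (by norm_num)]; norm_num
  obtain ⟨C, hC⟩ := exists_eLpNorm_fderiv_heatExtension_le_rpow E F (p := 3 / 2) (q := 2) h32 h32'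
  refine ⟨C, fun f hf t ht => ?_⟩
  have h := hC f hf t ht
  have hexp : -(1 / 2 + (Module.finrank ℝ E : ℝ) / 2 * ((1 / (3 / 2 : ℝ≥0∞)).toReal -
      (1 / (2 : ℝ≥0∞)).toReal)) = -(3 / 4 : ℝ) := by
    rw [hE]
    norm_num [ENNReal.toReal_div, ENNReal.toReal_ofNat]
  rwa [hexp] at h

end Literature.Analysis.UnboundedOperators
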